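import Summits.ABC.Harvest.GlueBakerXi
import HarnessLib

/-!
# ABC harvest — GLUE for door C9 (II): Baker's `Ξ`-conjecture ⟺ the refined abc conjecture (pair labelling) ⟹ abc

`Summits/ABC/Harvest/GlueBakerXiForm.lean` — cell `abc-harv`, seat abc-harv-pr-2 (KEY PR-BAKERXI), namespace
`Summit.ABC.Harvest`. PROOF-ONLY (no definition, no `sorry`, no axiom, no named fact), third file of the
C9 parcel after `BakerXi.lean` (the Props `BakerRefinedABC`, `BakerXiConjecture` + toolkit) and
`GlueBakerXi.lean` (`ε ⟺ ω` in both labellings).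

* `bakerXiConjecture_of_refinedPairs` — Baker 1998, easy half: the refined conjecture (pair labelling,
  `ε`-form) gives the `Ξ`-bound with the SAME constants (`Ξ(x,y) ≥ rad(x−y)/x`, `radical_div_le_bakerXi`).
* `omegaPairs_of_bakerXiConjecture` — main half: the `Ξ`-bound gives Conjecture 3 in the pair labelling
  (VERBATIM the hypothesis of `Summit.ABC.ABC.Theorems.soloInformed_abc_of_bakerConj3`), through the upper
  sandwich `Ξ(c,a) ≤ rad(b)/max(a,b)` (`bakerXi_le_radical_div_max`), the step `(★)`
  `c ≤ 2K ε^{−κω} N^{1+ε} c^{ε}` (`xi_star`), the a-priori `log c ≤ C₃ log N` from `(★)` at `ε = 1/2`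
  (`xi_apriori`, disposing of the height factor), Granville's `ε = κω/((1+C₃) log N)` and absorption.
* `bakerXiConjecture_iff_refinedPairs`, `bakerXiConjecture_iff_omegaPairs` (Baker 2004 p. 256 «Conjecture 3
  is equivalent to an estimate for `Ξ`»; Philippon 1999 p. 331 «il montre que sa version raffinée … est
  équivalente à la minoration `Ξ ≥ …`»), `abc_of_bakerXiConjecture` (door C9: A0, stronger hypothesis ⟹
  abc), `xiLowerBound_of_bakerXiConjecture` (above the tree's abc-strength `Ξ`-Prop),
  `bakerXiConjecture_iff_soloInformedXi` (= the tree's `ω`-currency `Ξ`-estimate).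

NOT PROVED, NOT CLAIMED: any arrow between the summand-labelled `BakerOmegaConjecture` / `BakerRefinedABC`
and the pair-labelled `BakerXiConjecture`; `ABC ⟹ BakerXiConjecture`. HONESTY LINE: abc is not proved by any
of this; typed ≠ proved; A-PS is NOT abc — «NOT abc — POLY-SZPIRO(E)».
-/

noncomputable section

open Real UniqueFactorizationMonoid
open scoped ArithmeticFunction.omega Nat

namespace Summit.ABC.Harvest

open Literature.NumberTheory.DiophantineGeometry
open Summit.ABC.ABC.Theorems

/-- **Baker 1998 (easy half): the refined abc conjecture, pair labelling, implies the `Ξ`-bound**, with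
the SAME constants: for coprime `x > y ≥ 1` apply the `ε`-form to the triple `y + (x − y) = x` and use
`Ξ(x,y) ≥ rad(x−y)/x` (`radical_div_le_bakerXi`) and `rad(x−y) ≤ x`.
[cite: Philippon1999, §3(b) (p. 331)] [cite: Baker2004, §2 (p. 256)] -/
theorem bakerXiConjecture_of_refinedPairs
    (h : ∃ κ : ℝ, 0 < κ ∧ ∃ K : ℝ, 0 < K ∧ ∀ ε : ℝ, 0 < ε → ∀ a b c : ℕ, IsABCTriple a b c →
        (c : ℝ) ≤ K * ε ^ (-(κ * (ω (c * a) : ℝ))) * ((rad a b c : ℕ) : ℝ) ^ (1 + ε)) :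
    BakerXiConjecture := by
  obtain ⟨κ, hκ, K, hK, hE⟩ := h
  refine ⟨κ, K, hκ, hK, fun ε hε x y hy hyx hcop => ?_⟩
  -- the triple `y + (x - y) = x`
  have htri : IsABCTriple y (x - y) x :=
    ⟨hy, by omega, by omega, (Nat.coprime_sub_self_right hyx.le).mpr hcop.symm⟩
  have hA := hE ε hε y (x - y) x htri
  have hradeq := rad_eq_mul_of_isABCTriple htri
  have hx0 : (0 : ℝ) < x := by exact_mod_cast (show 0 < x by omega)
  set Rx : ℝ := ((radical x : ℕ) : ℝ) with hRx
  set Ry : ℝ := ((radical y : ℕ) : ℝ) with hRy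
  set Rc : ℝ := ((radical (x - y) : ℕ) : ℝ) with hRc
  have hRx0 : 0 < Rx := by rw [hRx]; exact_mod_cast Nat.radical_pos x
  have hRy0 : 0 < Ry := by rw [hRy]; exact_mod_cast Nat.radical_pos y
  have hRc0 : 0 < Rc := by rw [hRc]; exact_mod_cast Nat.radical_pos (x - y)
  set P : ℝ := Rx * Ry with hP
  have hP0 : 0 < P := by positivity
  set E : ℝ := ε ^ (κ * (ω (x * y) : ℝ)) with hEdef
  have hE0 : 0 < E := Real.rpow_pos_of_pos hε _
  have hEneg : ε ^ (-(κ * (ω (x * y) : ℝ))) = E⁻¹ := Real.rpow_neg hε.le _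
  -- `Rc ≤ x`
  have hRc_le : Rc ≤ (x : ℝ) := by
    rw [hRc]
    have h1 : radical (x - y) ≤ x - y := Nat.radical_le_self_iff.mpr (by omega)
    exact_mod_cast h1.trans (Nat.sub_le x y)
  -- from the `ε`-form: `x ≤ K E⁻¹ P^{1+ε} Rc x^ε`
  have hPε : 0 < P ^ (1 + ε) := Real.rpow_pos_of_pos hP0 _
  have hxε : 0 < (x : ℝ) ^ ε := Real.rpow_pos_of_pos hx0 _
  have h1 : (x : ℝ) ≤ K * E⁻¹ * P ^ (1 + ε) * (x : ℝ) ^ ε * Rc := by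
    have hN : ((rad y (x - y) x : ℕ) : ℝ) = P * Rc := by rw [hradeq, hP]; ring
    have h2 : (P * Rc) ^ (1 + ε) = P ^ (1 + ε) * (Rc * Rc ^ ε) := by
      rw [Real.mul_rpow hP0.le hRc0.le, Real.rpow_add hRc0, Real.rpow_one]
    have h3 : Rc ^ ε ≤ (x : ℝ) ^ ε := Real.rpow_le_rpow hRc0.le hRc_le hε.le
    rw [hN, hEneg, h2] at hA
    calc (x : ℝ) ≤ K * E⁻¹ * (P ^ (1 + ε) * (Rc * Rc ^ ε)) := hA
      _ = K * E⁻¹ * P ^ (1 + ε) * Rc ^ ε * Rc := by ring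
      _ ≤ K * E⁻¹ * P ^ (1 + ε) * (x : ℝ) ^ ε * Rc := by gcongr
  -- target
  have hlow := radical_div_le_bakerXi hy hyx
  have h4 : K⁻¹ * E * P ^ (-(1 + ε)) * (x : ℝ) ^ (-ε) * (x : ℝ) ≤ Rc := by
    rw [Real.rpow_neg hP0.le, Real.rpow_neg hx0.le]
    calc K⁻¹ * E * (P ^ (1 + ε))⁻¹ * ((x : ℝ) ^ ε)⁻¹ * (x : ℝ)
        ≤ K⁻¹ * E * (P ^ (1 + ε))⁻¹ * ((x : ℝ) ^ ε)⁻¹ *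
            (K * E⁻¹ * P ^ (1 + ε) * (x : ℝ) ^ ε * Rc) :=
          mul_le_mul_of_nonneg_left h1 (by positivity)
      _ = Rc := by field_simp
  calc K⁻¹ * E * P ^ (-(1 + ε)) * (x : ℝ) ^ (-ε)
      = K⁻¹ * E * P ^ (-(1 + ε)) * (x : ℝ) ^ (-ε) * (x : ℝ) / (x : ℝ) := by field_simp
    _ ≤ Rc / (x : ℝ) := by gcongr
    _ ≤ bakerXi x y := hlow

/-- The upper half of Baker's sandwich for the tree's closed form: `Ξ(c, a) ≤ rad(b)/max(a, b)` on an abc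
triple `a + b = c` (`log(c/a) ≤ b/a` and `min(1,·) ≤ 1`). Cf. `soloInformed_bakerXi_le` (same bound for the
expanded product form). [cite: Baker2004, §2 (p. 256)] -/
theorem bakerXi_le_radical_div_max {a b c : ℕ} (ht : IsABCTriple a b c) :
    bakerXi c a ≤ ((radical b : ℕ) : ℝ) / max (a : ℝ) (b : ℝ) := by
  obtain ⟨ha, hb, hc, habc⟩ := soloInformed_xi_triple_pos ht
  have ha0 : (0 : ℝ) < a := by exact_mod_cast ha
  have hb0 : (0 : ℝ) < b := by exact_mod_cast hb
  have hcab : (c : ℝ) = a + b := by exact_mod_cast habc.symm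
  have hsub : c - a = b := by omega
  have hRb0 : (0 : ℝ) ≤ ((radical b : ℕ) : ℝ) := Nat.cast_nonneg _
  unfold bakerXi
  rw [hsub]
  rcases le_or_gt (b : ℝ) (a : ℝ) with hba | hab
  · -- `b ≤ a`: `min ≤ log(c/a) ≤ c/a - 1 = b/a`
    rw [max_eq_left hba]
    have hlog : Real.log ((c : ℝ) / a) ≤ (b : ℝ) / a := by
      have h := Real.log_le_sub_one_of_pos (show (0 : ℝ) < c / a by positivity)
      have : (c : ℝ) / a - 1 = (b : ℝ) / a := by rw [hcab]; field_simp; ring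
      linarith
    calc min 1 (Real.log ((c : ℝ) / a)) * (((radical b : ℕ) : ℝ) / b)
        ≤ (b : ℝ) / a * (((radical b : ℕ) : ℝ) / b) :=
          mul_le_mul_of_nonneg_right ((min_le_right _ _).trans hlog) (by positivity)
      _ = ((radical b : ℕ) : ℝ) / a := by field_simp
  · -- `a < b`: `min ≤ 1`
    rw [max_eq_right hab.le]
    calc min 1 (Real.log ((c : ℝ) / a)) * (((radical b : ℕ) : ℝ) / b)
        ≤ 1 * (((radical b : ℕ) : ℝ) / b) :=
          mul_le_mul_of_nonneg_right (min_le_left _ _) (by positivity)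
      _ = ((radical b : ℕ) : ℝ) / b := one_mul _

/-- **Step (★) of the `Ξ ⟹ ω` direction.** From the `Ξ`-bound with constants `κ, K` and the sandwich
`Ξ(c,a) ≤ rad(b)/max(a,b)`: `c ≤ 2K·ε^{−κω(ca)}·N^{1+ε}·c^{ε}` for every abc triple and every `ε > 0`
(the factor `c^{ε}` is the height term `H^{−ε}` of the `Ξ`-form). [cite: Baker2004, §2 (p. 256)] -/
theorem xi_star {κ K : ℝ} (hK : 0 < K)
    (hΞ : ∀ ε : ℝ, 0 < ε → ∀ a b : ℕ, 0 < b → b < a → Nat.Coprime a b →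
      K⁻¹ * ε ^ (κ * (ω (a * b) : ℝ)) *
          (((radical a : ℕ) : ℝ) * ((radical b : ℕ) : ℝ)) ^ (-(1 + ε)) * (a : ℝ) ^ (-ε) ≤
        bakerXi a b)
    {a b c : ℕ} (ht : IsABCTriple a b c) {ε : ℝ} (hε : 0 < ε) :
    (c : ℝ) ≤ 2 * K * ε ^ (-(κ * (ω (c * a) : ℝ))) * ((rad a b c : ℕ) : ℝ) ^ (1 + ε) *
      (c : ℝ) ^ ε := by
  obtain ⟨ha, hb, hc, habc⟩ := soloInformed_xi_triple_pos ht
  have hca : Nat.Coprime c a := by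
    rw [← habc, add_comm]; exact Nat.coprime_add_self_left.mpr ht.2.2.2.symm
  have hc0 : (0 : ℝ) < c := by exact_mod_cast hc
  have ha0 : (0 : ℝ) < a := by exact_mod_cast ha
  set N : ℝ := ((rad a b c : ℕ) : ℝ) with hN
  set w : ℝ := (ω (c * a) : ℝ) with hw
  set Ra : ℝ := ((radical a : ℕ) : ℝ) with hRa
  set Rb : ℝ := ((radical b : ℕ) : ℝ) with hRb
  set Rc : ℝ := ((radical c : ℕ) : ℝ) with hRc
  have hRa0 : 0 < Ra := by rw [hRa]; exact_mod_cast Nat.radical_pos a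
  have hRb1 : 1 ≤ Rb := by rw [hRb]; exact_mod_cast Nat.radical_pos b
  have hRb0 : 0 < Rb := by linarith
  have hRc0 : 0 < Rc := by rw [hRc]; exact_mod_cast Nat.radical_pos c
  have hNeq : N = Rc * Ra * Rb := by
    rw [hN, rad_eq_mul_of_isABCTriple ht]; ring
  have hM0 : 0 < max (a : ℝ) (b : ℝ) := lt_max_of_lt_left ha0
  have hcM : (c : ℝ) ≤ 2 * max (a : ℝ) (b : ℝ) := by
    have : (c : ℝ) = a + b := by exact_mod_cast habc.symm
    rw [this]; linarith [le_max_left (a : ℝ) b, le_max_right (a : ℝ) b]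
  have h1 := (hΞ ε hε c a ha (by omega) hca).trans (bakerXi_le_radical_div_max ht)
  set E : ℝ := ε ^ (κ * w) with hEdef
  have hE0 : 0 < E := Real.rpow_pos_of_pos hε _
  have hEneg : ε ^ (-(κ * w)) = E⁻¹ := Real.rpow_neg hε.le _
  have hP0 : 0 < Rc * Ra := by positivity
  have hPε : 0 < (Rc * Ra) ^ (1 + ε) := Real.rpow_pos_of_pos hP0 _
  have hcε : 0 < (c : ℝ) ^ ε := Real.rpow_pos_of_pos hc0 _
  rw [Real.rpow_neg hP0.le, Real.rpow_neg hc0.le, le_div_iff₀ hM0] at h1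
  -- `max a b ≤ K E⁻¹ (Rc Ra)^{1+ε} c^ε Rb`
  have h2 : max (a : ℝ) (b : ℝ) ≤ K * E⁻¹ * (Rc * Ra) ^ (1 + ε) * (c : ℝ) ^ ε * Rb := by
    calc max (a : ℝ) (b : ℝ)
        = (K * E⁻¹ * (Rc * Ra) ^ (1 + ε) * (c : ℝ) ^ ε) *
            (K⁻¹ * E * ((Rc * Ra) ^ (1 + ε))⁻¹ * ((c : ℝ) ^ ε)⁻¹ * max (a : ℝ) (b : ℝ)) := by
          field_simp
      _ ≤ (K * E⁻¹ * (Rc * Ra) ^ (1 + ε) * (c : ℝ) ^ ε) * Rb :=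
          mul_le_mul_of_nonneg_left h1 (by positivity)
  -- `(Rc Ra)^{1+ε} Rb ≤ N^{1+ε}`
  have h3 : (Rc * Ra) ^ (1 + ε) * Rb ≤ N ^ (1 + ε) := by
    have hRbε : Rb ≤ Rb ^ (1 + ε) := by
      calc Rb = Rb ^ (1 : ℝ) := (Real.rpow_one _).symm
        _ ≤ Rb ^ (1 + ε) := Real.rpow_le_rpow_of_exponent_le hRb1 (by linarith)
    calc (Rc * Ra) ^ (1 + ε) * Rb ≤ (Rc * Ra) ^ (1 + ε) * Rb ^ (1 + ε) := by gcongr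
      _ = N ^ (1 + ε) := by rw [hNeq, Real.mul_rpow hP0.le hRb0.le]
  calc (c : ℝ) ≤ 2 * max (a : ℝ) (b : ℝ) := hcM
    _ ≤ 2 * (K * E⁻¹ * (Rc * Ra) ^ (1 + ε) * (c : ℝ) ^ ε * Rb) := by linarith
    _ = 2 * K * E⁻¹ * ((Rc * Ra) ^ (1 + ε) * Rb) * (c : ℝ) ^ ε := by ring
    _ ≤ 2 * K * E⁻¹ * N ^ (1 + ε) * (c : ℝ) ^ ε := by gcongr
    _ = 2 * K * ε ^ (-(κ * w)) * N ^ (1 + ε) * (c : ℝ) ^ ε := by rw [hEneg]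

/-- **A-priori bound.** From `(★)` at `ε = 1/2`, `c ≤ 4K²·4^{κω}·N³`, so
`log c ≤ (2|log 2K|/log 2 + 2κ + 3)·log N` (using `ω log 2 ≤ log N`, `log N ≥ log 2`). [folklore] -/
theorem xi_apriori {κ K : ℝ} (hκ : 0 < κ) (hK : 0 < K) {a b c : ℕ} (ht : IsABCTriple a b c)
    (hstar : (c : ℝ) ≤ 2 * K * (1 / 2 : ℝ) ^ (-(κ * (ω (c * a) : ℝ))) *
      ((rad a b c : ℕ) : ℝ) ^ (1 + 1 / 2 : ℝ) * (c : ℝ) ^ (1 / 2 : ℝ)) :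
    Real.log (c : ℝ) ≤
      (2 * |Real.log (2 * K)| / Real.log 2 + 2 * κ + 3) * Real.log ((rad a b c : ℕ) : ℝ) := by
  obtain ⟨ha, hb, hc, habc⟩ := soloInformed_xi_triple_pos ht
  have hlog2 : (1 : ℝ) / 2 < Real.log 2 := by
    have := Real.log_two_gt_d9; norm_num at this ⊢; linarith
  have hl0 : 0 < Real.log 2 := by linarith
  have hc0 : (0 : ℝ) < c := by exact_mod_cast hc
  set N : ℝ := ((rad a b c : ℕ) : ℝ) with hN
  set w : ℝ := (ω (c * a) : ℝ) with hw
  set L : ℝ := Real.log N with hL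
  have hN2 : (2 : ℝ) ≤ N := by rw [hN]; exact_mod_cast ht.two_le_rad
  have hN0 : 0 < N := by linarith
  have hL2 : Real.log 2 ≤ L := by rw [hL]; exact Real.log_le_log (by norm_num) hN2
  have hL0 : 0 < L := lt_of_lt_of_le hl0 hL2
  have hdvd : c * a ∣ a * b * c := ⟨b, by ring⟩
  have hlog2w : w * Real.log 2 ≤ L :=
    BakerXi.mul_log_two_le_log (two_pow_cardDistinctFactors_le_rad_of_dvd ht hdvd)
  have hw0 : 0 ≤ w := Nat.cast_nonneg _
  have hhalf : (c : ℝ) ^ (1 / 2 : ℝ) * (c : ℝ) ^ (1 / 2 : ℝ) = c := by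
    rw [← Real.rpow_add hc0]; norm_num
  have hc12 : 0 < (c : ℝ) ^ (1 / 2 : ℝ) := Real.rpow_pos_of_pos hc0 _
  have htwo : (1 / 2 : ℝ) ^ (-(κ * w)) = (2 : ℝ) ^ (κ * w) := by
    rw [Real.rpow_neg (by norm_num), ← Real.inv_rpow (by norm_num)]; norm_num
  have h2 : (c : ℝ) ^ (1 / 2 : ℝ) ≤ 2 * K * (2 : ℝ) ^ (κ * w) * N ^ (1 + 1 / 2 : ℝ) := by
    rw [htwo] at hstar
    have : (c : ℝ) ^ (1 / 2 : ℝ) * (c : ℝ) ^ (1 / 2 : ℝ) ≤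
        (2 * K * (2 : ℝ) ^ (κ * w) * N ^ (1 + 1 / 2 : ℝ)) * (c : ℝ) ^ (1 / 2 : ℝ) := by
      rw [hhalf]; exact hstar
    exact le_of_mul_le_mul_right this hc12
  have h2K : 0 < 2 * K := by positivity
  have h2w : 0 < (2 : ℝ) ^ (κ * w) := Real.rpow_pos_of_pos (by norm_num) _
  have hN32 : 0 < N ^ (1 + 1 / 2 : ℝ) := Real.rpow_pos_of_pos hN0 _
  have h3 := Real.log_le_log hc12 h2
  rw [Real.log_rpow hc0, Real.log_mul (by positivity) hN32.ne', Real.log_mul h2K.ne' h2w.ne',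
    Real.log_rpow (by norm_num : (0:ℝ) < 2), Real.log_rpow hN0] at h3
  -- h3 : 1/2 * log c ≤ log (2K) + κ w log 2 + (1 + 1/2) L
  have h4 : Real.log (2 * K) ≤ |Real.log (2 * K)| / Real.log 2 * L := by
    have h1L : 1 ≤ L / Real.log 2 := by rw [le_div_iff₀ hl0]; linarith
    calc Real.log (2 * K) ≤ |Real.log (2 * K)| := le_abs_self _
      _ = |Real.log (2 * K)| * 1 := (mul_one _).symm
      _ ≤ |Real.log (2 * K)| * (L / Real.log 2) := mul_le_mul_of_nonneg_left h1L (abs_nonneg _)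
      _ = |Real.log (2 * K)| / Real.log 2 * L := by field_simp
  have h5 : κ * w * Real.log 2 ≤ κ * L := by
    have := mul_le_mul_of_nonneg_left hlog2w hκ.le
    linarith [this]
  calc Real.log (c : ℝ) ≤ 2 * Real.log (2 * K) + 2 * (κ * w * Real.log 2) + 3 * L := by
        linarith [h3]
    _ ≤ 2 * (|Real.log (2 * K)| / Real.log 2 * L) + 2 * (κ * L) + 3 * L := by linarith [h4, h5]
    _ = (2 * |Real.log (2 * K)| / Real.log 2 + 2 * κ + 3) * L := by ring

/-- **Baker 1998 (main half): the `Ξ`-bound implies Conjecture 3 in the pair labelling** — the output is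
VERBATIM the hypothesis of `soloInformed_abc_of_bakerConj3`. `(★)` (`xi_star`) and the a-priori bound
`log c ≤ C₃ log N` (`xi_apriori`) give `c ≤ 2K ε^{−κω} N^{1+(1+C₃)ε}`; then Granville's
`ε = κω/((1+C₃) log N)` (`BakerXi.optimal_eps_identity`) and absorption of `((1+C₃)e/κ)^{κω}`
(`BakerXi.exists_const_rpow_le_mul_div_rpow`). [cite: Philippon1999, §3(b) (p. 331)]
[cite: Baker2004, §2 (p. 256)] -/
theorem omegaPairs_of_bakerXiConjecture (h : BakerXiConjecture) :
    ∃ κ : ℝ, 0 < κ ∧ ∃ K : ℝ, 0 < K ∧ ∀ a b c : ℕ, IsABCTriple a b c →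
      (c : ℝ) ≤ K * ((rad a b c : ℕ) : ℝ) *
        (Real.log ((rad a b c : ℕ) : ℝ) / ω (c * a)) ^ (κ * ω (c * a)) := by
  obtain ⟨κ, K, hκ, hK, hΞ⟩ := h
  have hlog2 : (1 : ℝ) / 2 < Real.log 2 := by
    have := Real.log_two_gt_d9; norm_num at this ⊢; linarith
  have hl0 : 0 < Real.log 2 := by linarith
  -- the a-priori constant and the absorption constant
  set C₃ : ℝ := 2 * |Real.log (2 * K)| / Real.log 2 + 2 * κ + 3 with hC₃
  have hC₃0 : 0 < C₃ := by positivity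
  set B : ℝ := (1 + C₃) * (Real.exp 1 / κ) with hB
  have hB0 : 0 ≤ B := by positivity
  obtain ⟨C', hC'1, hC'⟩ := BakerXi.exists_const_rpow_le_mul_div_rpow (le_max_left 1 (B ^ κ))
  refine ⟨κ + 1, by positivity, 2 * K * C', by positivity, fun a b c ht => ?_⟩
  obtain ⟨ha, hb, hc, habc⟩ := soloInformed_xi_triple_pos ht
  -- notation
  set N : ℝ := ((rad a b c : ℕ) : ℝ) with hN
  set w : ℝ := (ω (c * a) : ℝ) with hw
  set L : ℝ := Real.log N with hL
  have hN2 : (2 : ℝ) ≤ N := by rw [hN]; exact_mod_cast ht.two_le_rad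
  have hN0 : 0 < N := by linarith
  have hL2 : Real.log 2 ≤ L := by rw [hL]; exact Real.log_le_log (by norm_num) hN2
  have hL0 : 0 < L := lt_of_lt_of_le hl0 hL2
  have hw1 : (1 : ℝ) ≤ w := by rw [hw]; exact_mod_cast soloInformed_one_le_omega_ca ht
  have hw0 : 0 < w := by linarith
  have hdvd : c * a ∣ a * b * c := ⟨b, by ring⟩
  have hlog2w : w * Real.log 2 ≤ L :=
    BakerXi.mul_log_two_le_log (two_pow_cardDistinctFactors_le_rad_of_dvd ht hdvd)
  have hfac : w * Real.log w - w ≤ L :=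
    BakerXi.mul_log_sub_le_log (factorial_cardDistinctFactors_le_rad_of_dvd ht hdvd)
  have hc0 : (0 : ℝ) < c := by exact_mod_cast hc
  -- Step 2: a-priori `log c ≤ C₃ L`
  have hapriori : Real.log (c : ℝ) ≤ C₃ * L := by
    rw [hC₃]; exact xi_apriori hκ hK ht (xi_star hK hΞ ht (by norm_num))
  -- Step 3: (★) at Granville's `ε₁ = κw/L'`, `L' = (1 + C₃) L`, with `c^{ε₁} ≤ e^{ε₁ C₃ L}`
  set L' : ℝ := (1 + C₃) * L with hL'
  have hL'0 : 0 < L' := by positivity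
  set ε₁ : ℝ := κ * w / L' with hε₁
  have hε₁0 : 0 < ε₁ := by positivity
  have h1 := xi_star hK hΞ ht hε₁0
  have hcε : (c : ℝ) ^ ε₁ ≤ Real.exp (ε₁ * (C₃ * L)) := by
    rw [Real.rpow_def_of_pos hc0, Real.exp_le_exp, mul_comm]
    exact mul_le_mul_of_nonneg_left hapriori hε₁0.le
  have hsplit : N ^ (1 + ε₁) = N * Real.exp (ε₁ * L) := by
    rw [Real.rpow_add hN0, Real.rpow_one, Real.rpow_def_of_pos hN0, hL, mul_comm (Real.log N)]
  have hexp : Real.exp (ε₁ * L) * Real.exp (ε₁ * (C₃ * L)) = Real.exp (ε₁ * L') := by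
    rw [← Real.exp_add, hL']; ring_nf
  have hopt : ε₁ ^ (-(κ * w)) * Real.exp (ε₁ * L') =
      (Real.exp 1 / κ) ^ (κ * w) * (L' / w) ^ (κ * w) := by
    have hid := BakerXi.optimal_eps_identity hκ hw0 hL'0
    have hεL : ε₁ * L' = κ * w / L' * L' := by rw [hε₁]
    rw [hεL, hε₁]; exact hid
  have hL'w : (L' / w) ^ (κ * w) = (1 + C₃) ^ (κ * w) * (L / w) ^ (κ * w) := by
    rw [← Real.mul_rpow (by positivity) (div_nonneg hL0.le hw0.le), hL', mul_div_assoc]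
  have hBpow : (Real.exp 1 / κ) ^ (κ * w) * (1 + C₃) ^ (κ * w) = B ^ (κ * w) := by
    rw [← Real.mul_rpow (by positivity) (by positivity), hB, mul_comm]
  have habs : B ^ (κ * w) ≤ C' * (L / w) ^ w := by
    calc B ^ (κ * w) = (B ^ κ) ^ w := Real.rpow_mul hB0 κ w
      _ ≤ (max 1 (B ^ κ)) ^ w :=
          Real.rpow_le_rpow (Real.rpow_nonneg hB0 κ) (le_max_right _ _) hw0.le
      _ ≤ C' * (L / w) ^ w := hC' w L hw1 hlog2w hfac
  have hs0 : 0 < L / w := div_pos hL0 hw0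
  have hpow : (L / w) ^ w * (L / w) ^ (κ * w) = (L / w) ^ ((κ + 1) * w) := by
    rw [← Real.rpow_add hs0]; ring_nf
  have hX0 : 0 ≤ (L / w) ^ (κ * w) := Real.rpow_nonneg hs0.le _
  have hY0 : 0 ≤ 2 * K * ε₁ ^ (-(κ * w)) * N ^ (1 + ε₁) := by positivity
  calc (c : ℝ) ≤ 2 * K * ε₁ ^ (-(κ * w)) * N ^ (1 + ε₁) * (c : ℝ) ^ ε₁ := h1
    _ ≤ 2 * K * ε₁ ^ (-(κ * w)) * N ^ (1 + ε₁) * Real.exp (ε₁ * (C₃ * L)) :=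
        mul_le_mul_of_nonneg_left hcε hY0
    _ = 2 * K * N * (ε₁ ^ (-(κ * w)) * (Real.exp (ε₁ * L) * Real.exp (ε₁ * (C₃ * L)))) := by
        rw [hsplit]; ring
    _ = 2 * K * N * ((Real.exp 1 / κ) ^ (κ * w) * (1 + C₃) ^ (κ * w) * (L / w) ^ (κ * w)) := by
        rw [hexp, hopt, hL'w]; ring
    _ = 2 * K * N * (B ^ (κ * w) * (L / w) ^ (κ * w)) := by rw [hBpow]
    _ ≤ 2 * K * N * (C' * (L / w) ^ w * (L / w) ^ (κ * w)) := by
        apply mul_le_mul_of_nonneg_left _ (by positivity)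
        exact mul_le_mul_of_nonneg_right habs hX0
    _ = 2 * K * C' * N * (L / w) ^ ((κ + 1) * w) := by rw [← hpow]; ring


/-- **GLUE (PROVED): Baker 1998's equivalence «refined abc ⟺ `Ξ` lower bound»** for the typed
`BakerXiConjecture`, the refined conjecture being the `ε`-form in Baker's pair labelling `ω(c·a)`.
[cite: Philippon1999, §3(b) (p. 331)] [cite: Baker2004, §2 (p. 256)] [cite: Baker1998] -/
theorem bakerXiConjecture_iff_refinedPairs :
    BakerXiConjecture ↔
      ∃ κ : ℝ, 0 < κ ∧ ∃ K : ℝ, 0 < K ∧ ∀ ε : ℝ, 0 < ε → ∀ a b c : ℕ, IsABCTriple a b c →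
        (c : ℝ) ≤ K * ε ^ (-(κ * (ω (c * a) : ℝ))) * ((rad a b c : ℕ) : ℝ) ^ (1 + ε) :=
  ⟨fun h => refinedPairs_iff_omegaPairs.mpr (omegaPairs_of_bakerXiConjecture h),
    bakerXiConjecture_of_refinedPairs⟩

/-- **GLUE (PROVED): `BakerXiConjecture` ⟺ Baker's Conjecture 3 in the pair labelling** («Conjecture 3
is equivalent to an estimate for `Ξ`», Baker 2004 p. 256) — the right-hand side is VERBATIM the hypothesis
of `Summit.ABC.ABC.Theorems.soloInformed_abc_of_bakerConj3`. [cite: Baker2004, §2 (p. 256)] -/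
theorem bakerXiConjecture_iff_omegaPairs :
    BakerXiConjecture ↔
      ∃ κ : ℝ, 0 < κ ∧ ∃ K : ℝ, 0 < K ∧ ∀ a b c : ℕ, IsABCTriple a b c →
        (c : ℝ) ≤ K * ((rad a b c : ℕ) : ℝ) *
          (Real.log ((rad a b c : ℕ) : ℝ) / ω (c * a)) ^ (κ * ω (c * a)) :=
  ⟨omegaPairs_of_bakerXiConjecture,
    fun h => bakerXiConjecture_of_refinedPairs (refinedPairs_iff_omegaPairs.mpr h)⟩

/-- **GLUE (PROVED), door C9: Baker's `Ξ`-conjecture ⟹ abc** (through Conjecture 3, pair labelling,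
`soloInformed_abc_of_bakerConj3`). A0 DOOR: the simultaneous summed-heights lower bound for one linear
form in two logarithms implies abc; abc is not proved by this. [cite: Baker2004, §2 (p. 256)]
[cite: BakerWustholz2007, §3.7 (pp. 69–70)] -/
theorem abc_of_bakerXiConjecture (h : BakerXiConjecture) : _root_.ABC :=
  soloInformed_abc_of_bakerConj3 (omegaPairs_of_bakerXiConjecture h)

/-- `BakerXiConjecture` lies above the tree's abc-strength `Ξ`-Prop `XiLowerBound` (`= ABC`,
`abc_iff_xiLowerBound`). [folklore] -/
theorem xiLowerBound_of_bakerXiConjecture (h : BakerXiConjecture) : XiLowerBound :=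
  xiLowerBound_of_abc (abc_of_bakerXiConjecture h)

/-- `BakerXiConjecture` (the `ε`-currency `Ξ`-estimate over `bakerXi`) ⟺ the tree's `ω`-currency
`Ξ`-estimate of `soloInformed_bakerConj3_iff_xiLowerBound` (`Ξ ≥ 1/(K rad(ca)((log N)/ω)^{κω})`, written
with the expanded product `min(1, log(c/a))·∏_{p∣b} min(1, p/p^{v_p(b)})`). [cite: Baker2004, §2 (p. 256)] -/
theorem bakerXiConjecture_iff_soloInformedXi :
    BakerXiConjecture ↔
      ∃ κ : ℝ, 0 < κ ∧ ∃ K : ℝ, 0 < K ∧ ∀ a b c : ℕ, IsABCTriple a b c →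
        (K * ((radical (c * a) : ℕ) : ℝ) *
            (Real.log ((rad a b c : ℕ) : ℝ) / ω (c * a)) ^ (κ * ω (c * a)))⁻¹ ≤
          (min 1 (Real.log ((c : ℝ) / (a : ℝ))) *
            ∏ p ∈ Nat.primeFactors b, min 1 ((p : ℝ) / (p : ℝ) ^ Nat.factorization b p)) :=
  bakerXiConjecture_iff_omegaPairs.trans soloInformed_bakerConj3_iff_xiLowerBound

end Summit.ABC.Harvest

end
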